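import Literature.Analysis.InverseSpectral.KreinString
import HarnessLib

/-!
# The calibration density of line `Sketch` (crux `LeeyangThesis`): bookkeeping

The calibration member of the telegraph-string family has density
`ρ_{L,A}(y) = 1 / ((L - y)² · log²(A / (L - y)))` on `[0, L)` and `0` elsewhere, with
`A ≥ e · L`.
This file supplies the elementary facts about `ρ_{L,A}` used by the line: it is measurable,
non-decreasing on `(-∞, L)`, continuous and strictly positive on `[0, L)`, and
`dm = ρ_{L,A} dy` restricted to `(-∞, L)` is the mass measure of a Kreĭn string of length `L`.

The only non-trivial point is monotonicity: with `t = L - y ∈ (0, L]` one has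
`ρ = 1 / (t · log(A/t))²`, and `t ↦ t · log(A/t)` is non-decreasing on `(0, A/e] ⊇ (0, L]`
(elementary: `t log t - s log s ≤ (t - s)(log t + 1) ≤ (t - s) log A` for `0 < s ≤ t ≤ A/e`,
using `log x ≤ x - 1`).
-/

noncomputable section

set_option linter.dupNamespace false

open MeasureTheory Filter Topology Set
open scoped ENNReal
open Literature.Analysis.InverseSpectral

namespace Summit.RiemannHypothesis.RiemannHypothesis.Theorems.LeeYangTelegraphString

/-- `t ↦ t · log(A / t)` is non-decreasing on `(0, A/e]`. -/
theorem calDensity_mul_log_mono {A s t : ℝ} (hs : 0 < s) (hst : s ≤ t)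
    (htA : Real.exp 1 * t ≤ A) : s * Real.log (A / s) ≤ t * Real.log (A / t) := by
  have ht : 0 < t := hs.trans_le hst
  have hA : 0 < A := lt_of_lt_of_le (by positivity) htA
  have h1 : Real.log (A / s) = Real.log A - Real.log s := Real.log_div hA.ne' hs.ne'
  have h2 : Real.log (A / t) = Real.log A - Real.log t := Real.log_div hA.ne' ht.ne'
  have h3 : Real.log (t / s) ≤ t / s - 1 := Real.log_le_sub_one_of_pos (by positivity)
  have h4 : Real.log (t / s) = Real.log t - Real.log s := Real.log_div ht.ne' hs.ne'
  have h5 : Real.log t ≤ Real.log A - 1 := by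
    have htA' : t ≤ A / Real.exp 1 := by
      rw [le_div_iff₀ (Real.exp_pos 1)]
      linarith [mul_comm (Real.exp 1) t]
    calc Real.log t ≤ Real.log (A / Real.exp 1) := Real.log_le_log ht htA'
      _ = Real.log A - 1 := by rw [Real.log_div hA.ne' (Real.exp_pos 1).ne', Real.log_exp]
  have h6 : s * (Real.log t - Real.log s) ≤ t - s := by
    have h7 := mul_le_mul_of_nonneg_left h3 hs.le
    rw [h4] at h7
    have e : s * (t / s - 1) = t - s := by field_simp
    linarith
  have h8 : 0 ≤ (t - s) * (Real.log A - 1 - Real.log t) :=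
    mul_nonneg (sub_nonneg.2 hst) (by linarith)
  rw [h1, h2]
  nlinarith [h6, h8]

/-- For `0 < t ≤ L ≤ A / e`: `1 ≤ log(A / t)`. -/
theorem calDensity_one_le_log {L A t : ℝ} (ht : 0 < t) (htL : t ≤ L)
    (hA : Real.exp 1 * L ≤ A) : 1 ≤ Real.log (A / t) := by
  have h1 : Real.exp 1 ≤ A / t := by
    rw [le_div_iff₀ ht]
    calc Real.exp 1 * t ≤ Real.exp 1 * L := mul_le_mul_of_nonneg_left htL (Real.exp_pos 1).le
      _ ≤ A := hA
  calc (1 : ℝ) = Real.log (Real.exp 1) := (Real.log_exp 1).symm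
    _ ≤ Real.log (A / t) := Real.log_le_log (Real.exp_pos 1) h1

section defining_equation

variable {L A : ℝ} {ρ : ℝ → ℝ}

/-- The calibration density on `[0, L)` is given by its formula. -/
theorem calDensity_apply_of_mem
    (hρ : ∀ y, ρ y =
      if 0 ≤ y ∧ y < L then 1 / ((L - y) ^ 2 * Real.log (A / (L - y)) ^ 2) else 0)
    {y : ℝ} (hy : y ∈ Set.Ico 0 L) :
    ρ y = 1 / ((L - y) ^ 2 * Real.log (A / (L - y)) ^ 2) := by
  rw [hρ, if_pos (show 0 ≤ y ∧ y < L from hy)]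

/-- The calibration density vanishes on `(-∞, 0)`. -/
theorem calDensity_apply_of_neg
    (hρ : ∀ y, ρ y =
      if 0 ≤ y ∧ y < L then 1 / ((L - y) ^ 2 * Real.log (A / (L - y)) ^ 2) else 0)
    {y : ℝ} (hy : y < 0) : ρ y = 0 := by
  rw [hρ, if_neg (fun h => absurd h.1 (not_le.2 hy))]

/-- The calibration density is non-negative everywhere. -/
theorem calDensity_nonneg
    (hρ : ∀ y, ρ y =
      if 0 ≤ y ∧ y < L then 1 / ((L - y) ^ 2 * Real.log (A / (L - y)) ^ 2) else 0)
    (y : ℝ) : 0 ≤ ρ y := by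
  rw [hρ]
  split_ifs
  · positivity
  · exact le_rfl

/-- The calibration density is strictly positive on `[0, L)`. -/
theorem calDensity_pos (hA : Real.exp 1 * L ≤ A)
    (hρ : ∀ y, ρ y =
      if 0 ≤ y ∧ y < L then 1 / ((L - y) ^ 2 * Real.log (A / (L - y)) ^ 2) else 0)
    {y : ℝ} (hy : y ∈ Set.Ico 0 L) : 0 < ρ y := by
  rw [calDensity_apply_of_mem hρ hy]
  have h1 : 0 < L - y := sub_pos.2 hy.2
  have h2 : 0 < Real.log (A / (L - y)) :=
    one_pos.trans_le (calDensity_one_le_log h1 (by linarith [hy.1]) hA)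
  exact div_pos one_pos (mul_pos (pow_pos h1 2) (pow_pos h2 2))

/-- The calibration density is measurable. -/
theorem calDensity_measurable
    (hρ : ∀ y, ρ y =
      if 0 ≤ y ∧ y < L then 1 / ((L - y) ^ 2 * Real.log (A / (L - y)) ^ 2) else 0) :
    Measurable ρ := by
  have h : ρ = fun y => if 0 ≤ y ∧ y < L then
      1 / ((L - y) ^ 2 * Real.log (A / (L - y)) ^ 2) else 0 := funext hρ
  rw [h]
  refine Measurable.ite measurableSet_Ico ?_ measurable_const
  exact measurable_const.div (((measurable_const.sub measurable_id).pow_const 2).mul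
    ((Real.measurable_log.comp
      (measurable_const.div (measurable_const.sub measurable_id))).pow_const 2))

/-- The calibration density is non-decreasing on `(-∞, L)`. -/
theorem calDensity_monotoneOn (hA : Real.exp 1 * L ≤ A)
    (hρ : ∀ y, ρ y =
      if 0 ≤ y ∧ y < L then 1 / ((L - y) ^ 2 * Real.log (A / (L - y)) ^ 2) else 0) :
    MonotoneOn ρ (Set.Iio L) := by
  intro y₁ hy₁ y₂ hy₂ h12
  by_cases h2 : 0 ≤ y₂
  · by_cases h1 : 0 ≤ y₁
    · rw [calDensity_apply_of_mem hρ ⟨h1, hy₁⟩, calDensity_apply_of_mem hρ ⟨h2, hy₂⟩]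
      have ht₂ : 0 < L - y₂ := sub_pos.2 hy₂
      have key :
          (L - y₂) * Real.log (A / (L - y₂)) ≤ (L - y₁) * Real.log (A / (L - y₁)) :=
        calDensity_mul_log_mono ht₂ (by linarith)
          ((mul_le_mul_of_nonneg_left (by linarith : L - y₁ ≤ L)
            (Real.exp_pos 1).le).trans hA)
      have pos₂ : 0 < (L - y₂) * Real.log (A / (L - y₂)) :=
        mul_pos ht₂ (one_pos.trans_le (calDensity_one_le_log ht₂ (by linarith) hA))
      rw [show (L - y₁) ^ 2 * Real.log (A / (L - y₁)) ^ 2 =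
          ((L - y₁) * Real.log (A / (L - y₁))) ^ 2 by ring,
        show (L - y₂) ^ 2 * Real.log (A / (L - y₂)) ^ 2 =
          ((L - y₂) * Real.log (A / (L - y₂))) ^ 2 by ring]
      exact one_div_le_one_div_of_le (pow_pos pos₂ 2) (pow_le_pow_left₀ pos₂.le key 2)
    · rw [calDensity_apply_of_neg hρ (not_le.1 h1)]
      exact calDensity_nonneg hρ y₂
  · have h1 : y₁ < 0 := lt_of_le_of_lt h12 (not_le.1 h2)
    rw [calDensity_apply_of_neg hρ h1, calDensity_apply_of_neg hρ (not_le.1 h2)]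

/-- The calibration density is continuous on `[0, L)`. -/
theorem calDensity_continuousOn (hL : 0 < L) (hA : Real.exp 1 * L ≤ A)
    (hρ : ∀ y, ρ y =
      if 0 ≤ y ∧ y < L then 1 / ((L - y) ^ 2 * Real.log (A / (L - y)) ^ 2) else 0) :
    ContinuousOn ρ (Set.Ico 0 L) := by
  have hA0 : 0 < A := lt_of_lt_of_le (by positivity) hA
  intro y hy
  have h1 : L - y ≠ 0 := (sub_pos.2 hy.2).ne'
  have h2 : A / (L - y) ≠ 0 := div_ne_zero hA0.ne' h1
  have h3 : 0 < Real.log (A / (L - y)) :=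
    one_pos.trans_le (calDensity_one_le_log (sub_pos.2 hy.2) (by linarith [hy.1]) hA)
  have h4 : (L - y) ^ 2 * Real.log (A / (L - y)) ^ 2 ≠ 0 :=
    mul_ne_zero (pow_ne_zero 2 h1) (pow_ne_zero 2 h3.ne')
  have hc : ContinuousAt (fun y : ℝ => 1 / ((L - y) ^ 2 * Real.log (A / (L - y)) ^ 2)) y := by
    refine continuousAt_const.div ?_ h4
    refine ((continuousAt_const.sub continuousAt_id).pow 2).mul ?_
    exact ((continuousAt_const.div (continuousAt_const.sub continuousAt_id) h1).log h2).pow 2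
  refine hc.continuousWithinAt.congr (fun z hz => ?_) ?_
  · exact calDensity_apply_of_mem hρ hz
  · exact calDensity_apply_of_mem hρ hy

/-- The measure `ρ dy` restricted to `(-∞, L)` does not charge `(-∞, 0)`. -/
theorem calDensity_measure_Iio_zero
    (hρ : ∀ y, ρ y =
      if 0 ≤ y ∧ y < L then 1 / ((L - y) ^ 2 * Real.log (A / (L - y)) ^ 2) else 0) :
    ((volume.withDensity fun y => ENNReal.ofReal (ρ y)).restrict (Set.Iio L)) (Set.Iio 0) = 0 := by
  refine le_antisymm ?_ zero_le
  calc ((volume.withDensity fun y => ENNReal.ofReal (ρ y)).restrict (Set.Iio L)) (Set.Iio 0)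
      ≤ (volume.withDensity fun y => ENNReal.ofReal (ρ y)) (Set.Iio 0) :=
        Measure.restrict_apply_le _ _
    _ = ∫⁻ y in Set.Iio 0, ENNReal.ofReal (ρ y) := withDensity_apply _ measurableSet_Iio
    _ = ∫⁻ _ in Set.Iio (0 : ℝ), (0 : ℝ≥0∞) :=
        setLIntegral_congr_fun measurableSet_Iio (fun y hy => by
          rw [calDensity_apply_of_neg hρ hy, ENNReal.ofReal_zero])
    _ = 0 := lintegral_zero

/-- The calibration density defines a Kreĭn string of length `L` with mass measure
`ρ dy` on `(-∞, L)`. -/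
theorem calDensity_string (hL : 0 < L) (hA : Real.exp 1 * L ≤ A)
    (hρ : ∀ y, ρ y =
      if 0 ≤ y ∧ y < L then 1 / ((L - y) ^ 2 * Real.log (A / (L - y)) ^ 2) else 0) :
    ∃ S : KreinString, S.length = ENNReal.ofReal L ∧
      S.massMeasure = (volume.withDensity fun y => ENNReal.ofReal (ρ y)).restrict (Set.Iio L) := by
  have hmono := calDensity_monotoneOn hA hρ
  have h0 := calDensity_measure_Iio_zero hρ
  refine ⟨⟨ENNReal.ofReal L, ENNReal.ofReal_pos.2 hL,
    (volume.withDensity fun y => ENNReal.ofReal (ρ y)).restrict (Set.Iio L), h0, ?_, ?_⟩,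
    rfl, rfl⟩
  · intro x hx
    have hxL : x < L := (ENNReal.ofReal_lt_ofReal_iff hL).1 hx
    have hsub : Set.Iic x ⊆ Set.Iio 0 ∪ Set.Icc 0 x := fun y hy =>
      (lt_or_ge y 0).elim Or.inl (fun h => Or.inr ⟨h, hy⟩)
    calc ((volume.withDensity fun y => ENNReal.ofReal (ρ y)).restrict (Set.Iio L)) (Set.Iic x)
        ≤ ((volume.withDensity fun y => ENNReal.ofReal (ρ y)).restrict (Set.Iio L))
            (Set.Iio 0 ∪ Set.Icc 0 x) := measure_mono hsub
      _ ≤ ((volume.withDensity fun y => ENNReal.ofReal (ρ y)).restrict (Set.Iio L)) (Set.Iio 0) +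
            ((volume.withDensity fun y => ENNReal.ofReal (ρ y)).restrict (Set.Iio L))
              (Set.Icc 0 x) := measure_union_le _ _
      _ = ((volume.withDensity fun y => ENNReal.ofReal (ρ y)).restrict (Set.Iio L))
            (Set.Icc 0 x) := by rw [h0, zero_add]
      _ ≤ (volume.withDensity fun y => ENNReal.ofReal (ρ y)) (Set.Icc 0 x) :=
            Measure.restrict_apply_le _ _
      _ = ∫⁻ y in Set.Icc 0 x, ENNReal.ofReal (ρ y) := withDensity_apply _ measurableSet_Icc
      _ ≤ ∫⁻ _ in Set.Icc 0 x, ENNReal.ofReal (ρ x) :=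
            setLIntegral_mono measurable_const (fun y hy =>
              ENNReal.ofReal_le_ofReal (hmono (show y < L from hy.2.trans_lt hxL) hxL hy.2))
      _ = ENNReal.ofReal (ρ x) * volume (Set.Icc 0 x) := setLIntegral_const _ _
      _ < ⊤ := ENNReal.mul_lt_top ENNReal.ofReal_lt_top measure_Icc_lt_top
  · intro x hx
    have hLx : L ≤ x := by
      by_contra h
      exact absurd hx (not_le.2 ((ENNReal.ofReal_lt_ofReal_iff hL).2 (not_le.1 h)))
    rw [Measure.restrict_apply measurableSet_Ici, Set.Ici_inter_Iio,
      Set.Ico_eq_empty (not_lt.2 hLx), measure_empty]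

end defining_equation

/-- The calibration density: measurability, monotonicity, continuity, positivity, and the string it
defines. -/
theorem stub_calDensity : ∀ (L A : ℝ), 0 < L → Real.exp 1 * L ≤ A →
    Measurable (fun y : ℝ => if 0 ≤ y ∧ y < L then
      1 / ((L - y) ^ 2 * Real.log (A / (L - y)) ^ 2) else 0) ∧
    MonotoneOn (fun y : ℝ => if 0 ≤ y ∧ y < L then
      1 / ((L - y) ^ 2 * Real.log (A / (L - y)) ^ 2) else 0) (Set.Iio L) ∧
    ContinuousOn (fun y : ℝ => if 0 ≤ y ∧ y < L then
      1 / ((L - y) ^ 2 * Real.log (A / (L - y)) ^ 2) else 0) (Set.Ico 0 L) ∧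
    (∀ y ∈ Set.Ico 0 L, 0 < (fun y : ℝ => if 0 ≤ y ∧ y < L then
      1 / ((L - y) ^ 2 * Real.log (A / (L - y)) ^ 2) else 0) y) ∧
    ∃ S : KreinString, S.length = ENNReal.ofReal L ∧
      S.massMeasure = (volume.withDensity fun y => ENNReal.ofReal
        ((fun y : ℝ => if 0 ≤ y ∧ y < L then
          1 / ((L - y) ^ 2 * Real.log (A / (L - y)) ^ 2) else 0) y)).restrict
        (Set.Iio L) := by
  intro L A hL hA
  have hρ : ∀ y, (fun y : ℝ => if 0 ≤ y ∧ y < L then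
      1 / ((L - y) ^ 2 * Real.log (A / (L - y)) ^ 2) else 0) y =
      if 0 ≤ y ∧ y < L then 1 / ((L - y) ^ 2 * Real.log (A / (L - y)) ^ 2) else 0 :=
    fun y => rfl
  exact ⟨calDensity_measurable hρ, calDensity_monotoneOn hA hρ,
    calDensity_continuousOn hL hA hρ, fun y hy => calDensity_pos hA hρ hy,
    calDensity_string hL hA hρ⟩

end Summit.RiemannHypothesis.RiemannHypothesis.Theorems.LeeYangTelegraphString

end
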